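import Summits.AnomalousDissipation.AnomalousDissipation.Theses.TwoAndHalfD

/-!
# Route TwoAndHalfD (AnomalousDissipation) — assembly item `Assembly`

Settles stmt-AnomalousDissipation-10787 (`Assembly := TwohalfdThesis → AnomalousDissipation`).
`TwohalfdThesis` is the zeroth law `AnomalousDissipation` (≡ `Literature.Turb.ZerothLaw`) with two
extra conjuncts recording invariance of the force `f` and of every slice `u j t` under the
translations `x ↦ x + s e₃` (the "two-and-a-half-dimensional" class). The implication simply
forgets those two conjuncts; it is the same implication as the route's deciding theorem
`Summit.AnomalousDissipation.AnomalousDissipation.Theses.TwoAndHalfD.closes` (D-0027 §2.1), but is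
proved here directly (destructure / repackage) so that this file does not depend on the generated
route file's proof script, only on the statements of `TwohalfdThesis` and `AnomalousDissipation`.
-/

namespace Summit.AnomalousDissipation.AnomalousDissipation.Theorems

-- D-0017: single-problem summit ⇒ `Summit.AnomalousDissipation.AnomalousDissipation.…` by design.
set_option linter.dupNamespace false

/-- Settles stmt-AnomalousDissipation-10787 (route `TwoAndHalfD`, assembly): the x₃-invariant
zeroth-law thesis `TwohalfdThesis` implies `AnomalousDissipation`. Proof: destructure the witness
`(f, ν, u₀, u, …)` of `TwohalfdThesis`, discard the two x₃-invariance conjuncts (on `f` and on the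
slices `u j t`), and repackage the remaining data verbatim as the witness of `AnomalousDissipation`. -/
theorem twoAndHalfDAssembly_proof :
    Summit.AnomalousDissipation.AnomalousDissipation.Theses.TwoAndHalfD.Assembly := by
  unfold Summit.AnomalousDissipation.AnomalousDissipation.Theses.TwoAndHalfD.Assembly
  rintro ⟨f, -, hfs, hfd, hfm, ν, u₀, u, hν, hν0, hLH, -, hE, hε⟩
  exact ⟨f, hfs, hfd, hfm, ν, u₀, u, hν, hν0, hLH, hE, hε⟩

end Summit.AnomalousDissipation.AnomalousDissipation.Theorems
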